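import Summits.ValiantsHypothesis.ValiantsHypothesis.Theorems.BarrierLeverAnchoredDoorHitsLowerPairsOnePeel
import Summits.ValiantsHypothesis.ValiantsHypothesis.Theorems.BarrierLeverAnchoredDoorHitsLowerPairsBlockPairing

/-!
# Support item `AnchoredDoorHitsLowerPairs` (stmt-ValiantsHypothesis-22510), line `anchored-peeling`:
# the one-peeled generalized layout has a ZERO BLOCK — module M1 (first part) of the UQ_s-step blueprint

Helper file (`--supports stmt-ValiantsHypothesis-22510`; cell valiant-natproofs, rung V4, 𝒟-side door (c); registered line
`Cruxes/AnchoredDoorHitsLowerPairs/Lines/anchored_peeling.lean` v12; prover seat val-np-p1 gen 19). Definition-free. Closes NO item.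

After the one-peel `a ↦ (a|c)` (p609893: rows `u i ∋ a` become `(u i ∖ a | {c})`, the others stay `(u i | ∅)`), the generalized layout matrix
`DTPeel.genMatrix s h r (onePeelU a u) (onePeelE a c u) w` has the block shape used by the UQ_s-step (memo HOME/val-np-p1/g19/PEEL-HALL-valnp1-g19.md §2/§4):
* `genEntry_onePeel_link_of_not_mem` — a LINK row (`a ∈ u i`) has entry `0` at every column avoiding `c` (**the zero block**);
* `genEntry_onePeel_link_of_mem` — at a column `w j ∋ c` its entry is the core coefficient `[x^{u i ∖ a} y^{w j ∖ c}] 𝔄_s`;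
* `genEntry_onePeel_del` — a DELETION row (`a ∉ u i`) keeps its ordinary entry `[x^{u i} y^{w j}] 𝔄_s`;
* `genDet_onePeel_ne_zero_of_blockPairing` — hence the block-pairing lemma (p615172, module M2) applies with `p i := a ∈ u i`, `q j := c ∉ w j`: independence of the
  link rows plus left-nondegeneracy of the kernel pairing give `genDet ≠ 0`, and then `symbolicDet s h r u w ≠ 0` (`symbolicDet_ne_zero_of_peel_genDet`).
What remains for the kernel UQ_s-step (modules M3–M4): identify the two kernels with the core syzygy space / link annihilator and extract the private monomial.

WHAT THIS IS NOT: no claim on any stub; nothing on crux stmt-ValiantsHypothesis-14610 or on `VP` versus `VNP`.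
-/

set_option linter.dupNamespace false

namespace Summit.ValiantsHypothesis.ValiantsHypothesis.Theorems.BarrierLever.AnchoredPeeling

open Finset MvPolynomial Matrix
open Summit.ValiantsHypothesis.ValiantsHypothesis.Theorems.BarrierLever.BrickCalculus (pexpo)

noncomputable section

variable {h r : ℕ}

/-- **Zero block.** A link row of the one-peeled layout vanishes at every column avoiding `c`. -/
theorem genEntry_onePeel_link_of_not_mem (s : ℕ) (u w : Fin r → Finset (Fin h)) (a c : Fin h) {i j : Fin r}
    (hi : a ∈ u i) (hj : c ∉ w j) :
    DTPeel.genEntry s h (DTPeel.onePeelU a u i) (DTPeel.onePeelE a c u i) (w j) = 0 := by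
  rw [DTPeel.genEntry, DTPeel.onePeelE, if_pos hi, if_neg]
  exact fun hsub => hj (hsub (Finset.mem_singleton_self c))

/-- A link row at a column through `c`: the core coefficient `[x^{u i ∖ a} y^{w j ∖ c}] 𝔄_s`. -/
theorem genEntry_onePeel_link_of_mem (s : ℕ) (u w : Fin r → Finset (Fin h)) (a c : Fin h) {i j : Fin r}
    (hi : a ∈ u i) (hj : c ∈ w j) :
    DTPeel.genEntry s h (DTPeel.onePeelU a u i) (DTPeel.onePeelE a c u i) (w j) =
      coeff (pexpo ((u i).erase a) ((w j).erase c)) (symbolicWitness s h) := by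
  rw [DTPeel.genEntry, DTPeel.onePeelE, if_pos hi, if_pos (Finset.singleton_subset_iff.mpr hj), DTPeel.onePeelU,
    Finset.sdiff_singleton_eq_erase]

/-- A deletion row keeps its ordinary entry `[x^{u i} y^{w j}] 𝔄_s`. -/
theorem genEntry_onePeel_del (s : ℕ) (u w : Fin r → Finset (Fin h)) (a c : Fin h) {i : Fin r} (j : Fin r)
    (hi : a ∉ u i) :
    DTPeel.genEntry s h (DTPeel.onePeelU a u i) (DTPeel.onePeelE a c u i) (w j) = coeff (pexpo (u i) (w j)) (symbolicWitness s h) := by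
  rw [DTPeel.genEntry, DTPeel.onePeelE, if_neg hi, if_pos (Finset.empty_subset _), DTPeel.onePeelU, Finset.erase_eq_of_notMem hi,
    Finset.sdiff_empty]

/-- **Module M1 ∘ M2.** If the link rows of the one-peeled layout are linearly independent and its kernel pairing is left-nondegenerate (in the sense of
`det_ne_zero_of_blockPairing`, with `p i := a ∈ u i`, `q j := c ∉ w j`), then the symbolic minor of `(u, w)` is nonzero. -/
theorem symbolicDet_ne_zero_of_onePeel_blockPairing {s : ℕ} (hs : 1 ≤ s) (u w : Fin r → Finset (Fin h)) (a c : Fin h)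
    (hE : ∀ z : Fin r → MvPolynomial (Param h) ℂ, (∀ i, a ∉ u i → z i = 0) →
      z ᵥ* DTPeel.genMatrix s h r (DTPeel.onePeelU a u) (DTPeel.onePeelE a c u) w = 0 → z = 0)
    (hpair : ∀ x : Fin r → MvPolynomial (Param h) ℂ, (∀ i, a ∈ u i → x i = 0) →
      (∀ j, c ∉ w j → (x ᵥ* DTPeel.genMatrix s h r (DTPeel.onePeelU a u) (DTPeel.onePeelE a c u) w) j = 0) → x ≠ 0 →
      ∃ y : Fin r → MvPolynomial (Param h) ℂ, (∀ j, c ∉ w j → y j = 0) ∧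
        (∀ i, a ∈ u i → (DTPeel.genMatrix s h r (DTPeel.onePeelU a u) (DTPeel.onePeelE a c u) w *ᵥ y) i = 0) ∧
        x ⬝ᵥ (DTPeel.genMatrix s h r (DTPeel.onePeelU a u) (DTPeel.onePeelE a c u) w *ᵥ y) ≠ 0) :
    symbolicDet s h r u w ≠ 0 := by
  refine symbolicDet_ne_zero_of_peel_genDet hs u w a c ?_
  rw [DTPeel.genDet]
  refine det_ne_zero_of_blockPairing _ (fun i => a ∈ u i) (fun j => c ∉ w j) (fun i j hi hj => ?_) hE hpair
  rw [DTPeel.genMatrix, Matrix.of_apply]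
  exact genEntry_onePeel_link_of_not_mem s u w a c hi hj

end

end Summit.ValiantsHypothesis.ValiantsHypothesis.Theorems.BarrierLever.AnchoredPeeling
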